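import Literature.Topology.PlanarFoliations.SeparatrixEnds
import Literature.Topology.PlanarFoliations.WalkFence
import Literature.Topology.PlanarFoliations.LeafIccPath
import HarnessLib

/-!
# Building the walk of a cycle of separatrices: junctions and links

Topic: Topology / PlanarFoliations, sequel to `SeparatrixEnds.lean` (a puncture which is a limit
set of an open leaf in a compact set is a saddle, and the leaf ends in prong tails),
`ProngTailsOrder.lean`, `LeafIccPath.lean`, `WalkFence.lean` (junctions `WalkJunction`, links).
Given star data `D` and a **cycle of separatrices** — punctures `vtx i` and open leaves `sx i`
(`i ∈ Fin m`) in a compact set `C`, the leaf of `sx i` having ω-limit set `{vtx i}` and the leaf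
of `sx (i + 1)` having α-limit set `{vtx i}` — we **build the walk data** consumed by the walk
fences:

* sub-tails (`FwdTail.ofMem`, `BwdTail.ofMem`) and tails based beyond / before a given point of
  the leaf (`FwdTail.exists_gt`, `BwdTail.exists_lt`);
* `JunctionChoice i` (**chosen**, `jc`): a forward tail of `sx i` and a backward tail of
  `sx (i + 1)` at the star of `vtx i`, separated by the base point of the leaf of `sx (i + 1)` /
  `sx i`, a common small parameter `β` and prong boxes at the two prong points; the junction
  `cycJ i : D.WalkJunction hι`;
* the **link** `cycℓ i` from `(cycJ i).Kout.base` to `(cycJ (i + 1)).Kin.base`: the leaf arc of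
  `sx (i + 1)` between the two prong points (`linkStart i < linkEnd i` in the leaf order — the
  tails were chosen apart), continuous in the leaf topology, injective, with range the closed leaf
  interval (`continuous_toLeafSpace_cycℓ`, `injective_cycℓ`, `range_cycℓ`);
* the `ℕ`-indexed periodic walk `walkJ`, `walkℓ` with `walkJ m = walkJ 0` (`walkJ_period`).

Also: prong points with positive parameter lie in one sector only (`ProngStar.eq_of_pt_mem_S`).

## References

* C. Camacho, A. Lins Neto, *Geometric Theory of Foliations*, Birkhäuser (1985), Ch. VII §2
  [CamachoLinsNeto1985].
-/

noncomputable section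

open Set Filter Function Metric unitInterval
open _root_.Topology
open Literature.Topology.FourManifolds Literature.Topology.FourManifolds.Foliation

namespace Literature.Topology.PlanarFoliations

variable {X : Type*} [TopologicalSpace X] {F : Foliation ℝ X} {ι : X → ℂ}

/-! ## Prong points lie in one sector -/

namespace ProngStar

variable {v : ℂ} {n : ℕ} (P : ProngStar F ι v n)

/-- **A prong point with positive parameter lies in its own sector only.** [folklore] -/
theorem eq_of_pt_mem_S {j j' : ZMod n} {β : ℝ} (hβ : β ∈ Ioc 0 P.ρ) (h : P.pt j (β, 0) ∈ P.S j') : j' = j := by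
  have hrect : ((β, 0) : ℝ × ℝ) ∈ P.rect := (P.mem_rect_iff).2 ⟨⟨hβ.1.le, hβ.2⟩, by simp [P.ρ_pos.le]⟩
  have hSj : P.pt j (β, 0) ∈ P.S j := P.pt_mem hrect
  have hne : P.pt j (β, 0) ≠ v := P.pt_ne hrect (by simp [hβ.1.ne'])
  have hb : P.b j (P.pt j (β, 0)) = β := P.b_pt hrect
  rcases P.eq_of_mem_inter j j' _ ⟨hSj, h⟩ hne with h1 | h1 | h1
  · exact h1
  · -- `j' = j + 1`: the point is on the shared half axis, `b = 0`
    subst h1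
    have hmem : P.pt j (β, 0) ∈ P.S j ∩ P.S (j + 1) := ⟨hSj, h⟩
    rw [P.inter_succ] at hmem
    rw [hmem.2.1] at hb
    exact absurd hb hβ.1.ne
  · -- `j = j' + 1`
    subst h1
    have hmem : P.pt (j' + 1) (β, 0) ∈ P.S j' ∩ P.S (j' + 1) := ⟨h, hSj⟩
    rw [P.inter_succ'] at hmem
    rw [hmem.2.1] at hb
    exact absurd hb hβ.1.ne

end ProngStar

/-! ## Sub-tails -/

namespace ProngStar

variable [T2Space X] [SecondCountableTopology X] {v : ℂ} {n : ℕ} {P : ProngStar F ι v n} {hbi : IsBiOriented F}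
variable {x : X} [NoncompactSpace (F.Leaf x)]

namespace FwdTail

variable (E : P.FwdTail hbi x)

/-- **The forward sub-tail based at a point of the tail.** [folklore] -/
def ofMem (hι : IsOpenEmbedding ι) (hω : v ∈ omegaSet hbi ι x) {q : F.Leaf x} (hq : q ∈ fwd hbi E.p) : P.FwdTail hbi x where
  j := E.j
  p := q
  β₀ := P.b E.j (ι (Leaf.pt q))
  hβ₀ := by
    obtain ⟨β, hβ, -, -, hb⟩ := E.mem_S_of_mem_fwd hq
    rw [hb]; exact ⟨hβ.1, hβ.2.trans E.hβ₀.2⟩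
  hp := by
    obtain ⟨β, -, hq', -, hb⟩ := E.mem_S_of_mem_fwd hq
    rw [hb]; exact hq'
  fwd_iff r := by
    constructor
    · intro hr
      have hrE : r ∈ fwd hbi E.p := fwd_mono hq hr
      obtain ⟨β, hβ, hr', -, hb⟩ := E.mem_S_of_mem_fwd hrE
      refine ⟨β, ⟨hβ.1, ?_⟩, hr'⟩
      rw [← hb]
      exact (E.mem_fwd_iff_b_le hι hω hq hrE).1 hr
    · rintro ⟨β, hβ, hr'⟩
      obtain ⟨βq, hβq, -, -, hbq⟩ := E.mem_S_of_mem_fwd hq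
      have hrE : r ∈ fwd hbi E.p := (E.fwd_iff r).2 ⟨β, ⟨hβ.1, hβ.2.trans (hbq ▸ hβq.2)⟩, hr'⟩
      refine (E.mem_fwd_iff_b_le hι hω hq hrE).2 ?_
      have hrect : ((β, 0) : ℝ × ℝ) ∈ P.rect :=
        (P.mem_rect_iff).2 ⟨⟨hβ.1.le, hβ.2.trans ((hbq ▸ hβq.2).trans E.hβ₀.2)⟩, by simp [P.ρ_pos.le]⟩
      rw [hr', P.b_pt hrect]
      exact hβ.2
  mem_closure := (mem_omegaSet_iff.1 hω) q

/-- The base point of the sub-tail. [folklore] -/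
@[simp] theorem ofMem_p (hι : IsOpenEmbedding ι) (hω : v ∈ omegaSet hbi ι x) {q : F.Leaf x} (hq : q ∈ fwd hbi E.p) :
    (E.ofMem hι hω hq).p = q := rfl

include E in
/-- **There is a forward tail based after any given point of the leaf.** [folklore] -/
theorem exists_gt (hι : IsOpenEmbedding ι) (hω : v ∈ omegaSet hbi ι x) (r : F.Leaf x) :
    ∃ E' : P.FwdTail hbi x, leafLT hbi r E'.p := by
  rcases leafLT_trichotomy (hbi := hbi) r E.p with h | h | h
  · exact ⟨E, h⟩
  · -- `r = E.p`: a point of the tail after it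
    have hr : r ∈ fwd hbi E.p := by rw [h]; exact mem_fwd_self _
    obtain ⟨β, hβ, -, -, hb⟩ := E.mem_S_of_mem_fwd hr
    obtain ⟨q, hq, hbq⟩ := E.exists_mem_fwd_b_eq hι hω hr (half_pos (hb ▸ hβ.1)) (by linarith [hb ▸ hβ.1])
    have hqE : q ∈ fwd hbi E.p := fwd_mono hr hq
    refine ⟨E.ofMem hι hω hqE, ?_⟩
    rw [ofMem_p]
    exact (E.leafLT_iff_b_lt hι hω hr hqE).2 (by rw [hbq]; linarith [hb ▸ hβ.1])
  · have hr : r ∈ fwd hbi E.p := mem_fwd_of_leafLT h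
    obtain ⟨β, hβ, -, -, hb⟩ := E.mem_S_of_mem_fwd hr
    obtain ⟨q, hq, hbq⟩ := E.exists_mem_fwd_b_eq hι hω hr (half_pos (hb ▸ hβ.1)) (by linarith [hb ▸ hβ.1])
    have hqE : q ∈ fwd hbi E.p := fwd_mono hr hq
    refine ⟨E.ofMem hι hω hqE, ?_⟩
    rw [ofMem_p]
    exact (E.leafLT_iff_b_lt hι hω hr hqE).2 (by rw [hbq]; linarith [hb ▸ hβ.1])

end FwdTail

namespace BwdTail

variable (E : P.BwdTail hbi x)

/-- **The backward sub-tail based at a point of the tail.** [folklore] -/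
def ofMem (hι : IsOpenEmbedding ι) (hα : v ∈ alphaSet hbi ι x) {q : F.Leaf x} (hq : q ∈ bwd hbi E.p) : P.BwdTail hbi x where
  j := E.j
  p := q
  β₀ := P.b E.j (ι (Leaf.pt q))
  hβ₀ := by
    obtain ⟨β, hβ, -, -, hb⟩ := E.mem_S_of_mem_bwd hq
    rw [hb]; exact ⟨hβ.1, hβ.2.trans E.hβ₀.2⟩
  hp := by
    obtain ⟨β, -, hq', -, hb⟩ := E.mem_S_of_mem_bwd hq
    rw [hb]; exact hq'
  bwd_iff r := by
    constructor
    · intro hr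
      have hrE : r ∈ bwd hbi E.p := bwd_mono hq hr
      obtain ⟨β, hβ, hr', -, hb⟩ := E.mem_S_of_mem_bwd hrE
      refine ⟨β, ⟨hβ.1, ?_⟩, hr'⟩
      rw [← hb]
      exact (E.mem_bwd_iff_b_le hι hα hq hrE).1 hr
    · rintro ⟨β, hβ, hr'⟩
      obtain ⟨βq, hβq, -, -, hbq⟩ := E.mem_S_of_mem_bwd hq
      have hrE : r ∈ bwd hbi E.p := (E.bwd_iff r).2 ⟨β, ⟨hβ.1, hβ.2.trans (hbq ▸ hβq.2)⟩, hr'⟩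
      refine (E.mem_bwd_iff_b_le hι hα hq hrE).2 ?_
      have hrect : ((β, 0) : ℝ × ℝ) ∈ P.rect :=
        (P.mem_rect_iff).2 ⟨⟨hβ.1.le, hβ.2.trans ((hbq ▸ hβq.2).trans E.hβ₀.2)⟩, by simp [P.ρ_pos.le]⟩
      rw [hr', P.b_pt hrect]
      exact hβ.2
  mem_closure := (mem_alphaSet_iff.1 hα) q

/-- The base point of the sub-tail. [folklore] -/
@[simp] theorem ofMem_p (hι : IsOpenEmbedding ι) (hα : v ∈ alphaSet hbi ι x) {q : F.Leaf x} (hq : q ∈ bwd hbi E.p) :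
    (E.ofMem hι hα hq).p = q := rfl

include E in
/-- **There is a backward tail based before any given point of the leaf.** [folklore] -/
theorem exists_lt (hι : IsOpenEmbedding ι) (hα : v ∈ alphaSet hbi ι x) (r : F.Leaf x) :
    ∃ E' : P.BwdTail hbi x, leafLT hbi E'.p r := by
  by_cases h : leafLT hbi E.p r
  · exact ⟨E, h⟩
  · -- `r ≤ E.p`: a point of the tail before it
    have hr : r ∈ bwd hbi E.p := h
    obtain ⟨β, hβ, -, -, hb⟩ := E.mem_S_of_mem_bwd hr
    obtain ⟨q, hq, hbq⟩ := E.exists_mem_bwd_b_eq hι hα hr (half_pos (hb ▸ hβ.1)) (by linarith [hb ▸ hβ.1])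
    have hqE : q ∈ bwd hbi E.p := bwd_mono hr hq
    refine ⟨E.ofMem hι hα hqE, ?_⟩
    rw [ofMem_p]
    exact (E.leafLT_iff_b_lt hι hα hr hqE).2 (by rw [hbq]; linarith [hb ▸ hβ.1])

end BwdTail

end ProngStar

/-! ## The junctions and links of a cycle of separatrices -/

variable [T2Space X] [SecondCountableTopology X] [Nonempty X]
variable {B : Type*} [NormedAddCommGroup B] {M : Type*} [TopologicalSpace M] {T : Foliation B M} {g : ℂ → M}
variable {hbi : IsBiOriented F}

namespace StarData

variable (D : StarData F ι T g) (hι : IsOpenEmbedding ι)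
variable {m : ℕ} [NeZero m] {C : Set ℂ} (hC : IsCompact C) {vtx : Fin m → ℂ} {sx : Fin m → X}
  [hnc : ∀ i, NoncompactSpace (F.Leaf (sx i))]
  (hv : ∀ i, vtx i ∈ D.P) (hmem : ∀ i, ∀ q : F.Leaf (sx i), ι (Leaf.pt q) ∈ C)
  (hω : ∀ i, omegaSet hbi ι (sx i) = {vtx i}) (hα : ∀ i, alphaSet hbi ι (sx (i + 1)) = {vtx i})

omit [Nonempty X] [NeZero m] in
include hC hv hmem hω in
/-- The punctures of the cycle are saddles. [folklore] -/
theorem nprong_vtx_ne_zero (i : Fin m) : D.nprong (vtx i) ≠ 0 := D.nprong_ne_zero_of_omegaSet (hv i) hC (hmem i) (hω i)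

/-- **The chosen data at the junction `i`**: tails of the incoming and outgoing separatrices at
the star of `vtx i`, based apart from the base points of their leaves, a common parameter and the
two prong boxes. [folklore] -/
structure JunctionChoice (i : Fin m) where
  /-- the forward tail of the incoming separatrix -/
  Ef : (D.star (vtx i) (D.nprong_vtx_ne_zero hC hv hmem hω i)).FwdTail hbi (sx i)
  /-- the backward tail of the outgoing separatrix -/
  Eb : (D.star (vtx i) (D.nprong_vtx_ne_zero hC hv hmem hω i)).BwdTail hbi (sx (i + 1))
  ref_lt : leafLT hbi (Leaf.base F (sx i)) Ef.p
  lt_ref : leafLT hbi Eb.p (Leaf.base F (sx (i + 1)))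
  /-- the parameter of the prong points -/
  β : ℝ
  hβin : β ∈ Ioc 0 Ef.β₀
  hβout : β ∈ Ioc 0 Eb.β₀
  /-- the prong box at the incoming prong point -/
  Kin : ProngBox (D.star (vtx i) (D.nprong_vtx_ne_zero hC hv hmem hω i)) hι Ef.j β
  /-- the prong box at the outgoing prong point -/
  Kout : ProngBox (D.star (vtx i) (D.nprong_vtx_ne_zero hC hv hmem hω i)) hι Eb.j β

include hα in
/-- **Junction data exist.** [folklore] -/
theorem nonempty_junctionChoice (i : Fin m) : Nonempty (D.JunctionChoice hι hC hv hmem hω i (hbi := hbi)) := by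
  have hv0 := D.nprong_vtx_ne_zero hC hv hmem hω i (hbi := hbi)
  haveI : NeZero (D.nprong (vtx i)) := ⟨hv0⟩
  set P := D.star (vtx i) hv0 with hP
  have hωi : vtx i ∈ omegaSet hbi ι (sx i) := by rw [hω i]; exact mem_singleton _
  have hαi : vtx i ∈ alphaSet hbi ι (sx (i + 1)) := by rw [hα i]; exact mem_singleton _
  obtain ⟨Ef₀⟩ := ProngStar.nonempty_fwdTail (P := P) (hbi := hbi) hι hC (hmem i) (hω i)
  obtain ⟨Eb₀⟩ := ProngStar.nonempty_bwdTail (P := P) (hbi := hbi) hι hC (hmem (i + 1)) (hα i)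
  obtain ⟨Ef, hEf⟩ := Ef₀.exists_gt hι hωi (Leaf.base F (sx i))
  obtain ⟨Eb, hEb⟩ := Eb₀.exists_lt hι hαi (Leaf.base F (sx (i + 1)))
  obtain ⟨β₁, hβ₁, hK₁⟩ := P.exists_prongBox hι Ef.j
  obtain ⟨β₂, hβ₂, hK₂⟩ := P.exists_prongBox hι Eb.j
  set β := min (min Ef.β₀ Eb.β₀) (min β₁ β₂) with hβ
  have hβpos : 0 < β := lt_min (lt_min Ef.hβ₀.1 Eb.hβ₀.1) (lt_min hβ₁.1 hβ₂.1)
  obtain ⟨Kin⟩ := hK₁ β ⟨hβpos, (min_le_right _ _).trans (min_le_left _ _)⟩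
  obtain ⟨Kout⟩ := hK₂ β ⟨hβpos, (min_le_right _ _).trans (min_le_right _ _)⟩
  exact ⟨⟨Ef, Eb, hEf, hEb, β, ⟨hβpos, (min_le_left _ _).trans (min_le_left _ _)⟩,
    ⟨hβpos, (min_le_left _ _).trans (min_le_right _ _)⟩, Kin, Kout⟩⟩

/-- The chosen junction data. [folklore] -/
def jc (i : Fin m) : D.JunctionChoice hι hC hv hmem hω i (hbi := hbi) :=
  Classical.choice (D.nonempty_junctionChoice hι hC hv hmem hω hα i)

/-- **The junction of the cycle at `vtx i`.** [folklore] -/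
def cycJ (i : Fin m) : D.WalkJunction hι where
  v := vtx i
  hv := D.nprong_vtx_ne_zero hC hv hmem hω i (hbi := hbi)
  jin := (D.jc hι hC hv hmem hω hα i).Ef.j
  jout := (D.jc hι hC hv hmem hω hα i).Eb.j
  β := (D.jc hι hC hv hmem hω hα i).β
  hβ := ⟨(D.jc hι hC hv hmem hω hα i).hβin.1.le, (D.jc hι hC hv hmem hω hα i).hβin.2.trans (D.jc hι hC hv hmem hω hα i).Ef.hβ₀.2⟩
  Kin := (D.jc hι hC hv hmem hω hα i).Kin
  Kout := (D.jc hι hC hv hmem hω hα i).Kout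

/-! ## The links -/

/-- The start of the link `i`: the point of the leaf of `sx (i + 1)` over the outgoing prong
point of the junction `i`. [folklore] -/
def linkStart (i : Fin m) : F.Leaf (sx (i + 1)) :=
  Classical.choose ((D.jc hι hC hv hmem hω hα i).Eb.exists_mem_bwd hι (D.jc hι hC hv hmem hω hα i).hβout)

/-- The start of the link is in the backward tail, over the prong point. [folklore] -/
theorem linkStart_spec (i : Fin m) :
    D.linkStart hι hC hv hmem hω hα i ∈ bwd hbi (D.jc hι hC hv hmem hω hα i).Eb.p ∧
      ι (Leaf.pt (D.linkStart hι hC hv hmem hω hα i)) =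
        (D.star (vtx i) (D.nprong_vtx_ne_zero hC hv hmem hω i (hbi := hbi))).pt (D.jc hι hC hv hmem hω hα i).Eb.j
          ((D.jc hι hC hv hmem hω hα i).β, 0) :=
  Classical.choose_spec ((D.jc hι hC hv hmem hω hα i).Eb.exists_mem_bwd hι (D.jc hι hC hv hmem hω hα i).hβout)

/-- The end of the link `i`: the point of the leaf of `sx (i + 1)` over the incoming prong point
of the junction `i + 1`. [folklore] -/
def linkEnd (i : Fin m) : F.Leaf (sx (i + 1)) :=
  Classical.choose ((D.jc hι hC hv hmem hω hα (i + 1)).Ef.exists_mem_fwd hι (D.jc hι hC hv hmem hω hα (i + 1)).hβin)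

/-- The end of the link is in the forward tail, over the prong point. [folklore] -/
theorem linkEnd_spec (i : Fin m) :
    D.linkEnd hι hC hv hmem hω hα i ∈ fwd hbi (D.jc hι hC hv hmem hω hα (i + 1)).Ef.p ∧
      ι (Leaf.pt (D.linkEnd hι hC hv hmem hω hα i)) =
        (D.star (vtx (i + 1)) (D.nprong_vtx_ne_zero hC hv hmem hω (i + 1) (hbi := hbi))).pt
          (D.jc hι hC hv hmem hω hα (i + 1)).Ef.j ((D.jc hι hC hv hmem hω hα (i + 1)).β, 0) :=
  Classical.choose_spec ((D.jc hι hC hv hmem hω hα (i + 1)).Ef.exists_mem_fwd hι (D.jc hι hC hv hmem hω hα (i + 1)).hβin)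

/-- The start of the link is the base point of the outgoing prong box. [folklore] -/
theorem pt_linkStart (i : Fin m) : Leaf.pt (D.linkStart hι hC hv hmem hω hα i) = (D.cycJ hι hC hv hmem hω hα i).Kout.base := by
  apply hι.injective
  rw [(D.linkStart_spec hι hC hv hmem hω hα i).2]
  exact ((D.jc hι hC hv hmem hω hα i).Kout.ι_base).symm

/-- The end of the link is the base point of the next incoming prong box. [folklore] -/
theorem pt_linkEnd (i : Fin m) : Leaf.pt (D.linkEnd hι hC hv hmem hω hα i) = (D.cycJ hι hC hv hmem hω hα (i + 1)).Kin.base := by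
  apply hι.injective
  rw [(D.linkEnd_spec hι hC hv hmem hω hα i).2]
  exact ((D.jc hι hC hv hmem hω hα (i + 1)).Kin.ι_base).symm

/-- **The link runs forward**: its start is before its end in the leaf order (the tails were
chosen apart). [folklore] -/
theorem linkStart_lt_linkEnd (i : Fin m) : leafLT hbi (D.linkStart hι hC hv hmem hω hα i) (D.linkEnd hι hC hv hmem hω hα i) := by
  set E := D.jc hι hC hv hmem hω hα i with hE
  set E' := D.jc hι hC hv hmem hω hα (i + 1) with hE'
  have h1 : ¬ leafLT hbi E.Eb.p (D.linkStart hι hC hv hmem hω hα i) := (D.linkStart_spec hι hC hv hmem hω hα i).1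
  have h2 : leafLT hbi E.Eb.p (Leaf.base F (sx (i + 1))) := E.lt_ref
  have h3 : leafLT hbi (Leaf.base F (sx (i + 1))) E'.Ef.p := E'.ref_lt
  have h4 : ¬ leafLT hbi (D.linkEnd hι hC hv hmem hω hα i) E'.Ef.p := (D.linkEnd_spec hι hC hv hmem hω hα i).1
  have h23 : leafLT hbi E.Eb.p E'.Ef.p := leafLT_trans h2 h3
  have h13 : leafLT hbi (D.linkStart hι hC hv hmem hω hα i) E'.Ef.p := by
    rcases not_leafLT_iff.1 h1 with h | h
    · exact leafLT_trans h h23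
    · rw [h]; exact h23
  rcases not_leafLT_iff.1 h4 with h | h
  · exact leafLT_trans h13 h
  · rw [← h]; exact h13

/-- **The link `i` of the cycle**: the leaf arc of `sx (i + 1)` from the outgoing prong point of
the junction `i` to the incoming prong point of the junction `i + 1`. [folklore] -/
def cycℓ (i : Fin m) : Path (D.cycJ hι hC hv hmem hω hα i).Kout.base (D.cycJ hι hC hv hmem hω hα (i + 1)).Kin.base :=
  (Classical.choose (exists_leafIccPath (D.linkStart_lt_linkEnd hι hC hv hmem hω hα i))).cast
    (D.pt_linkStart hι hC hv hmem hω hα i).symm (D.pt_linkEnd hι hC hv hmem hω hα i).symm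

/-- The properties of the link: continuous in the leaf topology, injective, with range the closed
leaf interval between its ends. [folklore] -/
theorem cycℓ_spec (i : Fin m) :
    Continuous (toLeafSpace ∘ D.cycℓ hι hC hv hmem hω hα i : I → F.LeafSpace) ∧ Injective (D.cycℓ hι hC hv hmem hω hα i) ∧
      ∀ y, y ∈ range (D.cycℓ hι hC hv hmem hω hα i) ↔
        ∃ r ∈ leafIcc hbi (D.linkStart hι hC hv hmem hω hα i) (D.linkEnd hι hC hv hmem hω hα i), Leaf.pt r = y :=
  Classical.choose_spec (exists_leafIccPath (D.linkStart_lt_linkEnd hι hC hv hmem hω hα i))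

/-- The link is continuous in the leaf topology. [folklore] -/
theorem continuous_toLeafSpace_cycℓ (i : Fin m) : Continuous (toLeafSpace ∘ D.cycℓ hι hC hv hmem hω hα i : I → F.LeafSpace) :=
  (D.cycℓ_spec hι hC hv hmem hω hα i).1

/-- The link is injective. [folklore] -/
theorem injective_cycℓ (i : Fin m) : Injective (D.cycℓ hι hC hv hmem hω hα i) :=
  (D.cycℓ_spec hι hC hv hmem hω hα i).2.1

/-- The range of the link is the closed leaf interval between its ends. [folklore] -/
theorem mem_range_cycℓ_iff (i : Fin m) {y : X} :
    y ∈ range (D.cycℓ hι hC hv hmem hω hα i) ↔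
      ∃ r ∈ leafIcc hbi (D.linkStart hι hC hv hmem hω hα i) (D.linkEnd hι hC hv hmem hω hα i), Leaf.pt r = y :=
  (D.cycℓ_spec hι hC hv hmem hω hα i).2.2 y

/-- The points of the link are on the leaf of `sx (i + 1)`. [folklore] -/
theorem cycℓ_mem_leaf (i : Fin m) (θ : I) : D.cycℓ hι hC hv hmem hω hα i θ ∈ F.leaf (sx (i + 1)) := by
  obtain ⟨r, -, hr⟩ := (D.mem_range_cycℓ_iff hι hC hv hmem hω hα i).1 ⟨θ, rfl⟩
  rw [← hr]
  exact r.2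

/-! ## The periodic walk -/

/-- The index of the cycle at the step `k` of the walk: `k mod m`. [folklore] -/
def idx (m : ℕ) [NeZero m] (k : ℕ) : Fin m := ⟨k % m, Nat.mod_lt _ (Nat.pos_of_neZero m)⟩

omit [NeZero m] in
/-- The value of the index. [folklore] -/
@[simp] theorem idx_val [NeZero m] (k : ℕ) : (idx m k).val = k % m := rfl

omit [NeZero m] in
/-- After `m` steps the index returns to `0`. [folklore] -/
theorem idx_self [NeZero m] : idx m m = idx m 0 := Fin.ext (by simp)

omit [NeZero m] in
/-- The index is `m`-periodic. [folklore] -/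
theorem idx_add [NeZero m] (k : ℕ) : idx m (k + m) = idx m k := Fin.ext (by simp)

omit [NeZero m] in
/-- The index of the next step. [folklore] -/
theorem idx_succ [NeZero m] (k : ℕ) : idx m (k + 1) = idx m k + 1 := by
  apply Fin.ext
  rw [Fin.val_add, idx_val, idx_val, Fin.val_one', Nat.add_mod]

/-- **The junctions of the walk around the cycle**, indexed by `ℕ`. [folklore] -/
def walkJ (k : ℕ) : D.WalkJunction hι := D.cycJ hι hC hv hmem hω hα (idx m k)

/-- The walk closes up after `m` steps. [folklore] -/
theorem walkJ_period : D.walkJ hι hC hv hmem hω hα m = D.walkJ hι hC hv hmem hω hα 0 := by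
  rw [walkJ, walkJ, idx_self]

/-- The junctions are `m`-periodic. [folklore] -/
theorem walkJ_add (k : ℕ) : D.walkJ hι hC hv hmem hω hα (k + m) = D.walkJ hι hC hv hmem hω hα k := by
  rw [walkJ, walkJ, idx_add]

/-- The next junction is the junction of the next index of the cycle. [folklore] -/
theorem walkJ_succ (k : ℕ) : D.walkJ hι hC hv hmem hω hα (k + 1) = D.cycJ hι hC hv hmem hω hα (idx m k + 1) := by
  rw [walkJ, idx_succ]

/-- **The links of the walk around the cycle**, indexed by `ℕ`. [folklore] -/
def walkℓ (k : ℕ) : Path (D.walkJ hι hC hv hmem hω hα k).Kout.base (D.walkJ hι hC hv hmem hω hα (k + 1)).Kin.base :=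
  (D.cycℓ hι hC hv hmem hω hα (idx m k)).cast rfl (by rw [walkJ_succ])

/-- The values of the links of the walk. [folklore] -/
theorem walkℓ_apply (k : ℕ) (θ : I) : D.walkℓ hι hC hv hmem hω hα k θ = D.cycℓ hι hC hv hmem hω hα (idx m k) θ := rfl

/-- The links of the walk are continuous in the leaf topology. [folklore] -/
theorem continuous_toLeafSpace_walkℓ (k : ℕ) : Continuous (toLeafSpace ∘ D.walkℓ hι hC hv hmem hω hα k : I → F.LeafSpace) :=
  D.continuous_toLeafSpace_cycℓ hι hC hv hmem hω hα (idx m k)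

end StarData

end Literature.Topology.PlanarFoliations
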